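import Literature.NumberTheory.EllipticCurves.SkinnerUrban2014.CharacteristicIdealBaseChangeProofs
import Literature.NumberTheory.IwasawaTheory.IwasawaAlgebraTwoVarRegularProofs
import Literature.NumberTheory.EllipticCurves.Rubin1991.TwoVariableMainConjecture
import Summits.BirchSwinnertonDyer.Rank1Residual.X1.CharIdealSquarePresentation
import Mathlib.RingTheory.PowerSeries.NoZeroDivisors
import HarnessLib

/-!
# The REVERSE base-change lane for characteristic ideals under `Fitt = Char` — the algebra of stub S2
# (`stub_specializationSS`) of line `bdpline` on the crux `AnticyclotomicEisensteinDivisibility`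
# (stmt-BirchSwinnertonDyer-20727, route SignedBaseChange)

Lead prover sbc-p1 g6 (2026-08-27). Stub S2 needs the inclusion `π(ch_{Λ₂}(X_Gr₂)) ⊆ ch_{Λ₁}(X_Gr₂/T₁X_Gr₂)`
(`π : Λ₂ ↠ Λ₁ = Λ₂/(T₁)`), i.e. the direction OPPOSITE to the printed Skinner–Urban lane
`Ch_{A/𝔞}(X/𝔞X) ⊆ Ch_A(X) mod 𝔞` (Cor. 3.2.9 (ii), tree `corollary329_charIdeal_quotient_le_map_charIdeal`);
in general the two differ by `ch_{Λ₁}(X[T₁])` (the item's why_might_fail: "the control factor ch(X[T₁]) sits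
on the wrong side"). This file PROVES the reverse lane in the case where the Fitting ideal computes the
characteristic ideal — e.g. modules with a SQUARE presentation (projective dimension ≤ 1, no non-zero
pseudo-null submodule) — by Fitting base change (Cor. 3.2.9 (i)) and `Fitt ⊆ Char` over the quotient:

* `map_charIdeal_le_charIdeal_baseChange_of_fittingIdeal_eq` — `A` any commutative ring, `𝔞 ⊂ A` with
  `A/𝔞` a Noetherian UFD, `X` finite with `Fitt_A(X) = Char_A(X)`: `Char_A(X) mod 𝔞 ⊆ Char_{A/𝔞}(X ⊗ A/𝔞)`;
  with the printed lane, EQUALITY (`charIdeal_baseChange_eq_map_of_fittingIdeal_eq`).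
* `map_charIdeal_coker_le_charIdeal_baseChange` — the square-presentation instance over any Noetherian UFD.
* `ker_constantCoeff_eq_span_X`, `isDomain_quotient_span_X`, `uniqueFactorizationMonoid_quotient_span_X`, the Λ₂-instance
  `map_charIdeal_coker_le_charIdeal_baseChange_twoVar` (Λ₂ = ℤ_p⟦T₂⟧⟦T₁⟧ is factorial —
  `IwasawaAlgebraTwoVarRegularProofs`; `Λ₂/(T₁) ≅ ℤ_p⟦T₂⟧` is a Noetherian UFD).
So S2 ⟸ [a square presentation (or just `Fitt = Char`) for `X_Gr₂` over `Λ₂`] + [control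
`X_Gr₂/T₁X_Gr₂ → X_Gr(E/K_∞⁻)` with finite cokernel] — both arithmetic inputs, not claimed here. Pure
commutative algebra; nothing asserted about curves; no new definitions.
-/

-- D-0017: single-problem summit, the namespace repeats the problem name by design.
set_option linter.dupNamespace false
set_option autoImplicit false

noncomputable section

open scoped TensorProduct Classical

namespace Summit.BirchSwinnertonDyer.BirchSwinnertonDyer.Theorems.SignedBaseChangeAcDivSpecialisationFitting

open Literature.NumberTheory.EllipticCurves Literature.NumberTheory.EllipticCurves.Module
  Literature.NumberTheory.EllipticCurves.SkinnerUrban2014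

universe u v

/-! ## §1. The reverse lane under `Fitt = Char` (any commutative ring `A`, quotient a Noetherian UFD) -/

/-- **Reverse base-change lane.** If `Fitt_A(X) = Char_A(X)` and `A/𝔞` is a Noetherian UFD, then
`Char_A(X) mod 𝔞 ⊆ Char_{A/𝔞}(X ⊗_A A/𝔞)`: Fitting ideals commute with base change (Cor. 3.2.9 (i))
and `Fitt ⊆ Char` over the Noetherian UFD `A/𝔞`. [cite: SkinnerUrban2014, §3.1.6 and Cor. 3.2.9 (i) (pp. 19–24)] -/
theorem map_charIdeal_le_charIdeal_baseChange_of_fittingIdeal_eq {A : Type u} [CommRing A]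
    (𝔞 : Ideal A) [IsNoetherianRing (A ⧸ 𝔞)] [IsDomain (A ⧸ 𝔞)] [UniqueFactorizationMonoid (A ⧸ 𝔞)]
    {X : Type v} [AddCommGroup X] [_root_.Module A X] [Module.Finite A X]
    (hFitt : Literature.RingTheory.FittingIdeal.Module.fittingIdeal A X 0 = charIdeal A X) :
    (charIdeal A X).map (Ideal.Quotient.mk 𝔞) ≤ charIdeal (A ⧸ 𝔞) ((A ⧸ 𝔞) ⊗[A] X) := by
  rw [← hFitt, ← fittingIdeal_quotient_baseChange]
  exact fittingIdeal_zero_le_charIdeal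

/-- **Both lanes: equality.** Under `Fitt_A(X) = Char_A(X)`, `Char_A(X)` principal and `X ⊗ A/𝔞`
torsion over the Noetherian UFD `A/𝔞` (with `A` a Noetherian UFD): `Char_{A/𝔞}(X ⊗ A/𝔞) = Char_A(X) mod 𝔞`.
[cite: SkinnerUrban2014, Cor. 3.2.9 (i), (ii) (p. 24)] -/
theorem charIdeal_baseChange_eq_map_of_fittingIdeal_eq {A : Type u} [CommRing A] [IsNoetherianRing A]
    [IsDomain A] [UniqueFactorizationMonoid A]
    (𝔞 : Ideal A) [IsDomain (A ⧸ 𝔞)] [UniqueFactorizationMonoid (A ⧸ 𝔞)]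
    {X : Type v} [AddCommGroup X] [_root_.Module A X] [Module.Finite A X]
    (hFitt : Literature.RingTheory.FittingIdeal.Module.fittingIdeal A X 0 = charIdeal A X) (hprinc : (charIdeal A X).IsPrincipal)
    (hT : _root_.Module.IsTorsion (A ⧸ 𝔞) ((A ⧸ 𝔞) ⊗[A] X)) :
    charIdeal (A ⧸ 𝔞) ((A ⧸ 𝔞) ⊗[A] X) = (charIdeal A X).map (Ideal.Quotient.mk 𝔞) :=
  le_antisymm (corollary329_charIdeal_quotient_le_map_charIdeal 𝔞 hprinc hT)
    (map_charIdeal_le_charIdeal_baseChange_of_fittingIdeal_eq 𝔞 hFitt)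

/-! ## §2. Square presentations -/

/-- **Square presentations have `Fitt = Char`** over a Noetherian UFD (`det ≠ 0`): both equal `(det P)`.
[cite: SkinnerUrban2014, §3.1.6 (p. 20)] [cite: StacksProject, Tag 07Z6] -/
theorem fittingIdeal_eq_charIdeal_coker {A : Type u} [CommRing A] [IsNoetherianRing A] [IsDomain A]
    [UniqueFactorizationMonoid A] {g : ℕ} (P : Matrix (Fin g) (Fin g) A) (hP : P.det ≠ 0) :
    Literature.RingTheory.FittingIdeal.Module.fittingIdeal A ((Fin g → A) ⧸ Submodule.span A (Set.range P)) 0 =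
      charIdeal A ((Fin g → A) ⧸ Submodule.span A (Set.range P)) := by
  rw [Summit.BirchSwinnertonDyer.Rank1Residual.X1.CharIdealSquarePresentation.fittingIdeal_zero_coker_eq_span_det,
    Summit.BirchSwinnertonDyer.Rank1Residual.X1.CharIdealSquarePresentation.charIdeal_coker_eq_span_det P hP]

/-- **Reverse lane for a square presentation**: for `X = A^g/(rows of P)`, `det P ≠ 0`, over a Noetherian
UFD `A` with `A/𝔞` a Noetherian UFD: `(det P) mod 𝔞 = Char_A(X) mod 𝔞 ⊆ Char_{A/𝔞}(X ⊗ A/𝔞)`.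
[cite: SkinnerUrban2014, §3.1.6 and Cor. 3.2.9 (pp. 19–24)] -/
theorem map_charIdeal_coker_le_charIdeal_baseChange {A : Type u} [CommRing A] [IsNoetherianRing A]
    [IsDomain A] [UniqueFactorizationMonoid A] (𝔞 : Ideal A) [IsDomain (A ⧸ 𝔞)]
    [UniqueFactorizationMonoid (A ⧸ 𝔞)] {g : ℕ} (P : Matrix (Fin g) (Fin g) A) (hP : P.det ≠ 0) :
    (charIdeal A ((Fin g → A) ⧸ Submodule.span A (Set.range P))).map (Ideal.Quotient.mk 𝔞) ≤
      charIdeal (A ⧸ 𝔞) ((A ⧸ 𝔞) ⊗[A] ((Fin g → A) ⧸ Submodule.span A (Set.range P))) :=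
  map_charIdeal_le_charIdeal_baseChange_of_fittingIdeal_eq 𝔞 (fittingIdeal_eq_charIdeal_coker P hP)

/-! ## §3. Over `Λ₂ = ℤ_p⟦T₂⟧⟦T₁⟧ → Λ₁ = Λ₂/(T₁)` -/

section TwoVar

/-- `ker(constantCoeff) = (X)` for power series over any commutative ring (`X ∣ φ ↔ φ(0) = 0`). [folklore] -/
theorem ker_constantCoeff_eq_span_X (R : Type u) [CommRing R] :
    RingHom.ker (PowerSeries.constantCoeff (R := R)) = Ideal.span {PowerSeries.X} := by
  ext φ
  rw [RingHom.mem_ker, Ideal.mem_span_singleton, PowerSeries.X_dvd_iff]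

/-- `R⟦X⟧/(X)` is a domain when `R` is (the ideal `(X)` is prime). [folklore] -/
theorem isDomain_quotient_span_X (R : Type u) [CommRing R] [IsDomain R] :
    IsDomain (PowerSeries R ⧸ Ideal.span {(PowerSeries.X : PowerSeries R)}) :=
  (Ideal.Quotient.isDomain_iff_prime _).mpr PowerSeries.span_X_isPrime

/-- `R⟦X⟧/(X)` is factorial when `R` is (transport along `R⟦X⟧/(X) ≃ R⟦X⟧/ker(constantCoeff) ≃ R`).
[folklore] -/
theorem uniqueFactorizationMonoid_quotient_span_X (R : Type u) [CommRing R] [IsDomain R]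
    [UniqueFactorizationMonoid R] :
    UniqueFactorizationMonoid (PowerSeries R ⧸ Ideal.span {(PowerSeries.X : PowerSeries R)}) :=
  haveI := isDomain_quotient_span_X R
  MulEquiv.uniqueFactorizationMonoid
    ((Ideal.quotEquivOfEq (ker_constantCoeff_eq_span_X R).symm).trans
      (RingHom.quotientKerEquivOfSurjective PowerSeries.constantCoeff_surj)).symm.toMulEquiv inferInstance

variable (p : ℕ) [Fact p.Prime]

/-- **The reverse lane over `Λ₂ → Λ₂/(T₁)` for a square presentation.** For `X = Λ₂^g/(rows of P)`,
`det P ≠ 0` (`Λ₂ = IwasawaAlgebra₂ p = ℤ_p⟦T₂⟧⟦T₁⟧`, `T₁ = PowerSeries.X`):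
`Char_{Λ₂}(X) mod (T₁) ⊆ Char_{Λ₂/(T₁)}(X ⊗ Λ₂/(T₁))` — the direction stub S2 needs, for modules so
presented. (`Λ₂` factorial: regular local rings are UFDs; `Λ₂/(T₁) ≅ ℤ_p⟦T₂⟧` factorial.)
[cite: SkinnerUrban2014, §3.1.6 and Cor. 3.2.9 (pp. 19–24)] [cite: Matsumura1987, Thm. 20.3] -/
theorem map_charIdeal_coker_le_charIdeal_baseChange_twoVar {g : ℕ}
    (P : Matrix (Fin g) (Fin g) (IwasawaAlgebra₂ p)) (hP : P.det ≠ 0) :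
    (charIdeal (IwasawaAlgebra₂ p)
        ((Fin g → IwasawaAlgebra₂ p) ⧸ Submodule.span (IwasawaAlgebra₂ p) (Set.range P))).map
        (Ideal.Quotient.mk (Ideal.span {(PowerSeries.X : IwasawaAlgebra₂ p)})) ≤
      charIdeal (IwasawaAlgebra₂ p ⧸ Ideal.span {(PowerSeries.X : IwasawaAlgebra₂ p)})
        ((IwasawaAlgebra₂ p ⧸ Ideal.span {(PowerSeries.X : IwasawaAlgebra₂ p)}) ⊗[IwasawaAlgebra₂ p]
          ((Fin g → IwasawaAlgebra₂ p) ⧸ Submodule.span (IwasawaAlgebra₂ p) (Set.range P))) := by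
  haveI : UniqueFactorizationMonoid (IwasawaAlgebra₂ p) :=
    Literature.NumberTheory.IwasawaTheory.uniqueFactorizationMonoid_powerSeries_powerSeries ℤ_[p]
  haveI := isDomain_quotient_span_X (IwasawaAlgebra p)
  haveI := uniqueFactorizationMonoid_quotient_span_X (IwasawaAlgebra p)
  exact map_charIdeal_coker_le_charIdeal_baseChange _ P hP

end TwoVar

end Summit.BirchSwinnertonDyer.BirchSwinnertonDyer.Theorems.SignedBaseChangeAcDivSpecialisationFitting

end
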